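import Summits.QuantumAdvantage.QuantumAdvantage.Theorems.LinnikCubicClassGroupsDegreeOnePrimesEscapeClassPNTDHPi
import Literature.NumberTheory.LFunctions.DeuringHeilbronn
import HarnessLib

/-!
# The class prime number theorem with relative error in the Linnik range, every degree, unconditionally

Topic `Summits/QuantumAdvantage/QuantumAdvantage/Theorems`, cell B2b-1 (linnik-cubic), PART A (gen 4);
helper toward the crux `DegreeOnePrimesEscape` (stmt-QuantumAdvantage-11543) of route
`LinnikCubicClassGroups`.  HONEST FRAMING: the value of this file is a THEOREM (kernel-checked, GRH-free,
Siegel-free, no hypothesis) — NOT summit progress (the route still rests on the hypothesis-type target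
`PureCubicClassNumberHard`).

`classPNT_relative`: Thorner–Zaman's Theorem 1.4 for the Hilbert class field `H_K/K` of EVERY number field
`K` of degree `n > 1`, in `π_C`-form and with no hypothesis: for every `ε > 0` there is `a₃ = a₃(n, ε)` such
that for all `x ≥ Q^{a₃}` (`Q = |d_K|·nⁿ`, `h = h_K`), EITHER `|π_C(x) − Li(x)/h| ≤ ε Li(x)/h` for every ideal
class `C`, OR there is one real class group character `χ₁` with a real zero `β₁` of `L(s, χ₁)` and
`|π_C(x) − G_C(x)/h| ≤ ε G_C(x)/h`, `G_C(x) = Li(x) − χ₁(C) Li(x^{β₁}) > 0`, for every `C`.  The only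
hypothesis of `classPNT_relative_of_zeroRepulsion` (the Deuring–Heilbronn phenomenon) is the tree's theorem
`Literature.NumberTheory.LFunctions.NumberField.deuringHeilbronn`.

References: J. Thorner, A. Zaman, Algebra Number Theory 13 (2019), Thm. 1.4 [ThornerZaman2019];
A. Weiss, J. reine angew. Math. 338 (1983) [Weiss1983];
J. C. Lagarias, H. L. Montgomery, A. M. Odlyzko, Invent. Math. 54 (1979) [LagariasMontgomeryOdlyzko1979].
-/

noncomputable section

open Complex Real MeasureTheory Set Filter Topology
open scoped NumberField nonZeroDivisors

namespace Summit.QuantumAdvantage.QuantumAdvantage.Theorems.DegreeOnePrimesEscape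

open Literature.NumberTheory.LFunctions Literature.NumberTheory.LFunctions.NumberField
  Literature.NumberTheory.LFunctions.AbelianDensity

/-- **The class prime number theorem in `π_C`-form with RELATIVE error in the Linnik range, every number
field of degree `n > 1`, unconditionally** (see the module docstring). [cite: ThornerZaman2019, Theorem 1.4]
[cite: Weiss1983, Theorem 5.2] -/
theorem classPNT_relative (n : ℕ) (hn : 1 < n) {ε : ℝ} (hε : 0 < ε) :
    ∃ a₃ c : ℝ, 1 ≤ a₃ ∧ 0 < c ∧ c ≤ 1 / (8 * ((n : ℝ) ^ 2 + 1)) ∧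
    ∀ (K : Type) [Field K] [NumberField K], Module.finrank ℚ K = n →
      (∀ x : ℝ, ThornerZaman.condQn K ^ a₃ ≤ x → ∀ C : ClassGroup (𝓞 K),
          |(primeIdealClassCount K C x : ℝ) - offsetLogIntegral x / NumberField.classNumber K| ≤
            ε * offsetLogIntegral x / NumberField.classNumber K) ∨
      ∃ (χ₁ : ClassGroup (𝓞 K) →* ℂˣ) (β₁ : ℝ), χ₁ * χ₁ = 1 ∧
          1 - c / (Real.log ((NumberField.discr K).natAbs : ℝ) + Real.log 4) < β₁ ∧ β₁ < 1 ∧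
          classGroupLFunction K χ₁ β₁ = 0 ∧
          ∀ x : ℝ, ThornerZaman.condQn K ^ a₃ ≤ x → ∀ C : ClassGroup (𝓞 K),
            0 < offsetLogIntegral x - ((χ₁ C : ℂ)).re * offsetLogIntegral (x ^ β₁) ∧
            |(primeIdealClassCount K C x : ℝ) -
                (offsetLogIntegral x - ((χ₁ C : ℂ)).re * offsetLogIntegral (x ^ β₁)) /
                  NumberField.classNumber K| ≤
              ε * (offsetLogIntegral x - ((χ₁ C : ℂ)).re * offsetLogIntegral (x ^ β₁)) /
                NumberField.classNumber K :=
  classPNT_relative_of_zeroRepulsion deuringHeilbronn n hn hε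

end Summit.QuantumAdvantage.QuantumAdvantage.Theorems.DegreeOnePrimesEscape

end
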